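import Mathlib
import Summits.FinalStateConjecture.FinalStateConjecture.Theorems.EternalPapapetrouSchwarzschildExteriorModeRigidityJetConv
import HarnessLib

/-!
# Route EternalPapapetrou · SchwarzschildExteriorModeRigidity — the raw jet and its mollification

Helper file for item stmt-FinalStateConjecture-10039 (`SchwarzschildExteriorModeRigidity`).

* `RWJet.ofContDiff`: a `C²` solution of the reduced system on the strip gives a jet (partials
  as Fréchet derivatives, symmetry of second derivatives from `C²`).
* `RWJet.smoothJet`: time convolution with a continuous compactly supported kernel maps jets to
  jets (no bounds needed: everything is local, by compactness).
[folklore]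
-/

set_option linter.dupNamespace false

noncomputable section

namespace Summit.FinalStateConjecture.FinalStateConjecture.Theorems

open MeasureTheory Set Filter Topology Metric

namespace EternalPapapetrou.ModeRigidity

variable {E : Type*} [NormedAddCommGroup E] [NormedSpace ℝ E] [CompleteSpace E]

omit [CompleteSpace E] in
/-- A continuous linear map on `ℝ × ℝ` is `L₁` of its values on the basis. [folklore] -/
theorem clm_eq_L₁ (f : ℝ × ℝ →L[ℝ] E) : f = L₁ (f e₁) (f e₂) := by
  apply ContinuousLinearMap.ext fun v ↦ ?_
  have hv : v = v.1 • e₁ + v.2 • e₂ := by ext <;> simp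
  conv_lhs => rw [hv]
  rw [map_add, map_smul, map_smul, L₁_apply]

namespace RWJet

variable {M : ℝ} {Λ : E →L[ℝ] E}

omit [CompleteSpace E] in
/-- **The jet of a `C²` solution.** [folklore] -/
def ofContDiff (M : ℝ) (Λ : E →L[ℝ] E) (u : ℝ × ℝ → E) (hu : ContDiffOn ℝ 2 u (strip M))
    (hpde : ∀ p ∈ strip M, rwOp M Λ p.2 (u p) (fderiv ℝ u p e₁) (fderiv ℝ u p e₂)
      (fderiv ℝ (fun q ↦ fderiv ℝ u q e₁) p e₁) (fderiv ℝ (fun q ↦ fderiv ℝ u q e₁) p e₂)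
      (fderiv ℝ (fun q ↦ fderiv ℝ u q e₂) p e₂) = 0) : RWJet M Λ where
  V := u
  Vt p := fderiv ℝ u p e₁
  Vr p := fderiv ℝ u p e₂
  Vtt p := fderiv ℝ (fun q ↦ fderiv ℝ u q e₁) p e₁
  Vtr p := fderiv ℝ (fun q ↦ fderiv ℝ u q e₁) p e₂
  Vrr p := fderiv ℝ (fun q ↦ fderiv ℝ u q e₂) p e₂
  hasFDerivAt p hp := by
    have hd : DifferentiableAt ℝ u p :=
      (hu.contDiffAt ((isOpen_strip M).mem_nhds hp)).differentiableAt (by norm_num)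
    exact hd.hasFDerivAt.congr_fderiv (clm_eq_L₁ _)
  hasFDerivAt_t p hp := by
    have h1 : ContDiffOn ℝ 1 (fderiv ℝ u) (strip M) :=
      hu.fderiv_of_isOpen (isOpen_strip M) (by norm_num)
    have hd : DifferentiableAt ℝ (fderiv ℝ u) p :=
      (h1.contDiffAt ((isOpen_strip M).mem_nhds hp)).differentiableAt (by norm_num)
    have key : HasFDerivAt (fun q ↦ fderiv ℝ u q e₁)
        ((ContinuousLinearMap.apply ℝ E e₁).comp (fderiv ℝ (fderiv ℝ u) p)) p :=
      (ContinuousLinearMap.apply ℝ E e₁).hasFDerivAt.comp p hd.hasFDerivAt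
    refine key.congr_fderiv ?_
    rw [key.fderiv]
    exact clm_eq_L₁ _
  hasFDerivAt_r p hp := by
    have h1 : ContDiffOn ℝ 1 (fderiv ℝ u) (strip M) :=
      hu.fderiv_of_isOpen (isOpen_strip M) (by norm_num)
    have hd : DifferentiableAt ℝ (fderiv ℝ u) p :=
      (h1.contDiffAt ((isOpen_strip M).mem_nhds hp)).differentiableAt (by norm_num)
    have keyt : HasFDerivAt (fun q ↦ fderiv ℝ u q e₁)
        ((ContinuousLinearMap.apply ℝ E e₁).comp (fderiv ℝ (fderiv ℝ u) p)) p :=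
      (ContinuousLinearMap.apply ℝ E e₁).hasFDerivAt.comp p hd.hasFDerivAt
    have keyr : HasFDerivAt (fun q ↦ fderiv ℝ u q e₂)
        ((ContinuousLinearMap.apply ℝ E e₂).comp (fderiv ℝ (fderiv ℝ u) p)) p :=
      (ContinuousLinearMap.apply ℝ E e₂).hasFDerivAt.comp p hd.hasFDerivAt
    have hsymm : IsSymmSndFDerivAt ℝ u p :=
      (hu.contDiffAt ((isOpen_strip M).mem_nhds hp)).isSymmSndFDerivAt (by simp)
    refine keyr.congr_fderiv ?_
    have h2 : fderiv ℝ (fun q ↦ fderiv ℝ u q e₁) p e₂ =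
        ((ContinuousLinearMap.apply ℝ E e₂).comp (fderiv ℝ (fderiv ℝ u) p)) e₁ := by
      rw [keyt.fderiv]
      simp only [ContinuousLinearMap.coe_comp, Function.comp_apply, ContinuousLinearMap.apply_apply]
      exact hsymm e₂ e₁
    rw [h2, keyr.fderiv]
    exact clm_eq_L₁ _
  cont_tt := by
    have h1 : ContDiffOn ℝ 1 (fderiv ℝ u) (strip M) :=
      hu.fderiv_of_isOpen (isOpen_strip M) (by norm_num)
    have h2 : ContinuousOn (fderiv ℝ (fderiv ℝ u)) (strip M) :=
      h1.continuousOn_fderiv_of_isOpen (isOpen_strip M) le_rfl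
    have h3 : ContinuousOn (fun p ↦ fderiv ℝ (fderiv ℝ u) p e₁ e₁) (strip M) :=
      ((ContinuousLinearMap.apply ℝ E e₁).continuous.comp
        (ContinuousLinearMap.apply ℝ _ e₁).continuous).comp_continuousOn h2
    refine h3.congr fun p hp ↦ ?_
    have hd : DifferentiableAt ℝ (fderiv ℝ u) p :=
      (h1.contDiffAt ((isOpen_strip M).mem_nhds hp)).differentiableAt (by norm_num)
    have key : HasFDerivAt (fun q ↦ fderiv ℝ u q e₁)
        ((ContinuousLinearMap.apply ℝ E e₁).comp (fderiv ℝ (fderiv ℝ u) p)) p :=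
      (ContinuousLinearMap.apply ℝ E e₁).hasFDerivAt.comp p hd.hasFDerivAt
    show fderiv ℝ (fun q ↦ fderiv ℝ u q e₁) p e₁ = fderiv ℝ (fderiv ℝ u) p e₁ e₁
    rw [key.fderiv]
    rfl
  cont_tr := by
    have h1 : ContDiffOn ℝ 1 (fderiv ℝ u) (strip M) :=
      hu.fderiv_of_isOpen (isOpen_strip M) (by norm_num)
    have h2 : ContinuousOn (fderiv ℝ (fderiv ℝ u)) (strip M) :=
      h1.continuousOn_fderiv_of_isOpen (isOpen_strip M) le_rfl
    have h3 : ContinuousOn (fun p ↦ fderiv ℝ (fderiv ℝ u) p e₂ e₁) (strip M) :=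
      ((ContinuousLinearMap.apply ℝ E e₁).continuous.comp
        (ContinuousLinearMap.apply ℝ _ e₂).continuous).comp_continuousOn h2
    refine h3.congr fun p hp ↦ ?_
    have hd : DifferentiableAt ℝ (fderiv ℝ u) p :=
      (h1.contDiffAt ((isOpen_strip M).mem_nhds hp)).differentiableAt (by norm_num)
    have key : HasFDerivAt (fun q ↦ fderiv ℝ u q e₁)
        ((ContinuousLinearMap.apply ℝ E e₁).comp (fderiv ℝ (fderiv ℝ u) p)) p :=
      (ContinuousLinearMap.apply ℝ E e₁).hasFDerivAt.comp p hd.hasFDerivAt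
    show fderiv ℝ (fun q ↦ fderiv ℝ u q e₁) p e₂ = fderiv ℝ (fderiv ℝ u) p e₂ e₁
    rw [key.fderiv]
    rfl
  cont_rr := by
    have h1 : ContDiffOn ℝ 1 (fderiv ℝ u) (strip M) :=
      hu.fderiv_of_isOpen (isOpen_strip M) (by norm_num)
    have h2 : ContinuousOn (fderiv ℝ (fderiv ℝ u)) (strip M) :=
      h1.continuousOn_fderiv_of_isOpen (isOpen_strip M) le_rfl
    have h3 : ContinuousOn (fun p ↦ fderiv ℝ (fderiv ℝ u) p e₂ e₂) (strip M) :=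
      ((ContinuousLinearMap.apply ℝ E e₂).continuous.comp
        (ContinuousLinearMap.apply ℝ _ e₂).continuous).comp_continuousOn h2
    refine h3.congr fun p hp ↦ ?_
    have hd : DifferentiableAt ℝ (fderiv ℝ u) p :=
      (h1.contDiffAt ((isOpen_strip M).mem_nhds hp)).differentiableAt (by norm_num)
    have key : HasFDerivAt (fun q ↦ fderiv ℝ u q e₂)
        ((ContinuousLinearMap.apply ℝ E e₂).comp (fderiv ℝ (fderiv ℝ u) p)) p :=
      (ContinuousLinearMap.apply ℝ E e₂).hasFDerivAt.comp p hd.hasFDerivAt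
    show fderiv ℝ (fun q ↦ fderiv ℝ u q e₂) p e₂ = fderiv ℝ (fderiv ℝ u) p e₂ e₂
    rw [key.fderiv]
    rfl
  pde := hpde

/-! ### Local bounds from compact support of the kernel -/

omit [NormedSpace ℝ E] [CompleteSpace E] in
/-- If `U` is continuous on the strip and `k` has compact support, then `U (q.1 - s, q.2)` is
bounded for `k s ≠ 0` and `q` in the half-distance ball around a point of the strip. [folklore] -/
theorem local_bound {M : ℝ} {U : ℝ × ℝ → E} (hU : ContinuousOn U (strip M)) {k : ℝ → ℝ}
    (hks : HasCompactSupport k) {p₀ : ℝ × ℝ} (hp₀ : p₀ ∈ strip M) :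
    ∃ C, ∀ s, k s ≠ 0 → ∀ q : ℝ × ℝ, dist q p₀ < (p₀.2 - 2 * M) / 2 →
      ‖U (q.1 - s, q.2)‖ ≤ C := by
  obtain ⟨ρ, hρ⟩ := (isBounded_iff_subset_closedBall (0 : ℝ)).1 hks.isCompact.isBounded
  set ε := (p₀.2 - 2 * M) / 2 with hε
  have hε0 : 0 < ε := by have := hp₀.2; simp only [mem_Ioi] at this; rw [hε]; linarith
  set K : Set (ℝ × ℝ) := Icc (p₀.1 - ε - ρ) (p₀.1 + ε + ρ) ×ˢ Icc (p₀.2 - ε) (p₀.2 + ε) with hK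
  have hKc : IsCompact K := isCompact_Icc.prod isCompact_Icc
  have hKs : K ⊆ strip M := by
    rintro ⟨t, r⟩ ⟨-, hr⟩
    refine ⟨mem_univ _, ?_⟩
    show 2 * M < r
    have := hr.1; rw [hε] at this; linarith
  obtain ⟨C, hC⟩ := hKc.exists_bound_of_continuousOn (hU.mono hKs)
  refine ⟨C, fun s hs q hq ↦ hC _ ?_⟩
  have hsρ : |s| ≤ ρ := by
    have : s ∈ closedBall (0 : ℝ) ρ := hρ (subset_tsupport _ (Function.mem_support.2 hs))
    simpa [Real.norm_eq_abs] using this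
  have h1 : |q.1 - p₀.1| < ε := by
    have : dist q.1 p₀.1 ≤ dist q p₀ := by rw [Prod.dist_eq]; exact le_max_left _ _
    rw [Real.dist_eq] at this
    exact lt_of_le_of_lt this hq
  have h2 := abs_lt.1 (abs_snd_sub_lt_of_dist_lt hq)
  have h1' := abs_lt.1 h1
  have hs' := abs_le.1 hsρ
  exact ⟨⟨by linarith, by linarith⟩, ⟨by linarith, by linarith⟩⟩

omit [CompleteSpace E] in
/-- `timeConv k U` is continuous on the strip for continuous `U` and continuous compactly
supported `k`. [folklore] -/
theorem continuousOn_timeConv_of_hasCompactSupport {k : ℝ → ℝ} (hkc : Continuous k)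
    (hks : HasCompactSupport k) {U : ℝ × ℝ → E} {M : ℝ} (hU : ContinuousOn U (strip M)) :
    ContinuousOn (timeConv k U) (strip M) := by
  have hk : Integrable k := hkc.integrable_of_hasCompactSupport hks
  intro p₀ hp₀
  have hr₀ : 2 * M < p₀.2 := hp₀.2
  set ε := (p₀.2 - 2 * M) / 2 with hε
  have hε0 : 0 < ε := by rw [hε]; linarith
  obtain ⟨C, hC⟩ := local_bound hU hks hp₀
  refine ContinuousAt.continuousWithinAt ?_
  show ContinuousAt (fun x : ℝ × ℝ ↦ ∫ s, k s • U (x.1 - s, x.2)) p₀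
  refine continuousAt_of_dominated (bound := fun s ↦ ‖k s‖ * C) ?_ ?_ (hk.norm.mul_const C) ?_
  · filter_upwards [ball_mem_nhds p₀ hε0] with q hq
    exact hk.aestronglyMeasurable.smul
      (continuous_slice hU q.1 (ball_strip q hq).2).aestronglyMeasurable
  · filter_upwards [ball_mem_nhds p₀ hε0] with q hq
    refine Eventually.of_forall fun s ↦ ?_
    by_cases hs : k s = 0
    · simp [hs]
    · rw [norm_smul]
      exact mul_le_mul_of_nonneg_left (hC s hs q hq) (norm_nonneg _)
  · refine Eventually.of_forall fun s ↦ ?_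
    have hmem : ((p₀.1 - s, p₀.2) : ℝ × ℝ) ∈ strip M := ⟨mem_univ _, hr₀⟩
    have h1 : ContinuousAt U (p₀.1 - s, p₀.2) := hU.continuousAt ((isOpen_strip M).mem_nhds hmem)
    have h2 : ContinuousAt (fun x : ℝ × ℝ ↦ ((x.1 - s, x.2) : ℝ × ℝ)) p₀ := by fun_prop
    exact (h1.comp_of_eq h2 rfl).const_smul (k s)

/-- **Mollification of a jet by a continuous compactly supported kernel is a jet.** [folklore] -/
def smoothJet (J : RWJet M Λ) {k : ℝ → ℝ} (hkc : Continuous k) (hks : HasCompactSupport k) :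
    RWJet M Λ :=
  have hk : Integrable k := hkc.integrable_of_hasCompactSupport hks
  { V := timeConv k J.V
    Vt := timeConv k J.Vt
    Vr := timeConv k J.Vr
    Vtt := timeConv k J.Vtt
    Vtr := timeConv k J.Vtr
    Vrr := timeConv k J.Vrr
    hasFDerivAt := by
      intro p₀ hp₀
      have hε : 0 < (p₀.2 - 2 * M) / 2 := by have := hp₀.2; simp only [mem_Ioi] at this; linarith
      obtain ⟨C₀, hC₀⟩ := local_bound J.continuousOn hks hp₀
      have hc' : ContinuousOn (fun p ↦ L₁ (J.Vt p) (J.Vr p)) (strip M) :=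
        continuous_L₁.comp_continuousOn (J.continuousOn_t.prodMk J.continuousOn_r)
      obtain ⟨C₁, hC₁⟩ := local_bound hc' hks hp₀
      obtain ⟨Ct, hCt⟩ := local_bound J.continuousOn_t hks hp₀
      obtain ⟨Cr, hCr⟩ := local_bound J.continuousOn_r hks hp₀
      have key := hasFDerivAt_timeConv hk J.continuousOn J.hasFDerivAt hc' (C := max C₀ C₁) hε
        (fun q hq ↦ (ball_strip q hq).2)
        (fun s hs q hq ↦ ⟨(hC₀ s hs q hq).trans (le_max_left _ _),
          (hC₁ s hs q hq).trans (le_max_right _ _)⟩)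
      refine key.congr_fderiv (timeConv_L₁ ?_ ?_)
      · exact integrable_timeConv_integrand hk J.continuousOn_t hp₀.2
          fun s hs ↦ hCt s hs p₀ (by simp [hε])
      · exact integrable_timeConv_integrand hk J.continuousOn_r hp₀.2
          fun s hs ↦ hCr s hs p₀ (by simp [hε])
    hasFDerivAt_t := by
      intro p₀ hp₀
      have hε : 0 < (p₀.2 - 2 * M) / 2 := by have := hp₀.2; simp only [mem_Ioi] at this; linarith
      obtain ⟨C₀, hC₀⟩ := local_bound J.continuousOn_t hks hp₀
      have hc' : ContinuousOn (fun p ↦ L₁ (J.Vtt p) (J.Vtr p)) (strip M) :=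
        continuous_L₁.comp_continuousOn (J.cont_tt.prodMk J.cont_tr)
      obtain ⟨C₁, hC₁⟩ := local_bound hc' hks hp₀
      obtain ⟨Ct, hCt⟩ := local_bound J.cont_tt hks hp₀
      obtain ⟨Cr, hCr⟩ := local_bound J.cont_tr hks hp₀
      have key := hasFDerivAt_timeConv hk J.continuousOn_t J.hasFDerivAt_t hc' (C := max C₀ C₁) hε
        (fun q hq ↦ (ball_strip q hq).2)
        (fun s hs q hq ↦ ⟨(hC₀ s hs q hq).trans (le_max_left _ _),
          (hC₁ s hs q hq).trans (le_max_right _ _)⟩)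
      refine key.congr_fderiv (timeConv_L₁ ?_ ?_)
      · exact integrable_timeConv_integrand hk J.cont_tt hp₀.2
          fun s hs ↦ hCt s hs p₀ (by simp [hε])
      · exact integrable_timeConv_integrand hk J.cont_tr hp₀.2
          fun s hs ↦ hCr s hs p₀ (by simp [hε])
    hasFDerivAt_r := by
      intro p₀ hp₀
      have hε : 0 < (p₀.2 - 2 * M) / 2 := by have := hp₀.2; simp only [mem_Ioi] at this; linarith
      obtain ⟨C₀, hC₀⟩ := local_bound J.continuousOn_r hks hp₀
      have hc' : ContinuousOn (fun p ↦ L₁ (J.Vtr p) (J.Vrr p)) (strip M) :=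
        continuous_L₁.comp_continuousOn (J.cont_tr.prodMk J.cont_rr)
      obtain ⟨C₁, hC₁⟩ := local_bound hc' hks hp₀
      obtain ⟨Ct, hCt⟩ := local_bound J.cont_tr hks hp₀
      obtain ⟨Cr, hCr⟩ := local_bound J.cont_rr hks hp₀
      have key := hasFDerivAt_timeConv hk J.continuousOn_r J.hasFDerivAt_r hc' (C := max C₀ C₁) hε
        (fun q hq ↦ (ball_strip q hq).2)
        (fun s hs q hq ↦ ⟨(hC₀ s hs q hq).trans (le_max_left _ _),
          (hC₁ s hs q hq).trans (le_max_right _ _)⟩)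
      refine key.congr_fderiv (timeConv_L₁ ?_ ?_)
      · exact integrable_timeConv_integrand hk J.cont_tr hp₀.2
          fun s hs ↦ hCt s hs p₀ (by simp [hε])
      · exact integrable_timeConv_integrand hk J.cont_rr hp₀.2
          fun s hs ↦ hCr s hs p₀ (by simp [hε])
    cont_tt := continuousOn_timeConv_of_hasCompactSupport hkc hks J.cont_tt
    cont_tr := continuousOn_timeConv_of_hasCompactSupport hkc hks J.cont_tr
    cont_rr := continuousOn_timeConv_of_hasCompactSupport hkc hks J.cont_rr
    pde := by
      intro p hp
      have hε : 0 < (p.2 - 2 * M) / 2 := by have := hp.2; simp only [mem_Ioi] at this; linarith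
      have hpp : dist p p < (p.2 - 2 * M) / 2 := by simp [hε]
      obtain ⟨C₀, hC₀⟩ := local_bound J.continuousOn hks hp
      obtain ⟨C₁, hC₁⟩ := local_bound J.continuousOn_t hks hp
      obtain ⟨C₂, hC₂⟩ := local_bound J.continuousOn_r hks hp
      obtain ⟨C₃, hC₃⟩ := local_bound J.cont_tt hks hp
      obtain ⟨C₄, hC₄⟩ := local_bound J.cont_tr hks hp
      obtain ⟨C₅, hC₅⟩ := local_bound J.cont_rr hks hp
      set C := max (max (max C₀ C₁) (max C₂ C₃)) (max C₄ C₅) with hC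
      rw [rwOp_timeConv M Λ hk (C := C) (continuous_slice J.continuousOn p.1 hp.2)
        (continuous_slice J.continuousOn_t p.1 hp.2) (continuous_slice J.continuousOn_r p.1 hp.2)
        (continuous_slice J.cont_tt p.1 hp.2) (continuous_slice J.cont_tr p.1 hp.2)
        (continuous_slice J.cont_rr p.1 hp.2)
        (fun s hs ↦ (hC₀ s hs p hpp).trans (by simp [hC]))
        (fun s hs ↦ (hC₁ s hs p hpp).trans (by simp [hC]))
        (fun s hs ↦ (hC₂ s hs p hpp).trans (by simp [hC]))
        (fun s hs ↦ (hC₃ s hs p hpp).trans (by simp [hC]))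
        (fun s hs ↦ (hC₄ s hs p hpp).trans (by simp [hC]))
        (fun s hs ↦ (hC₅ s hs p hpp).trans (by simp [hC]))]
      rw [timeConv_congr k (W := fun _ ↦ (0 : E)) fun τ ↦ J.pde (τ, p.2) ⟨mem_univ _, hp.2⟩]
      exact timeConv_zero_fun k p }

end RWJet

end EternalPapapetrou.ModeRigidity

end Summit.FinalStateConjecture.FinalStateConjecture.Theorems
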